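import Summits.ResolutionOfSingularities.ResolutionOfSingularities.Theorems.PurelyInseparableDim4ShadeTwoSwapRead
import Summits.ResolutionOfSingularities.ResolutionOfSingularities.Theorems.PurelyInseparableDim4ResConeShadeTwoFrameWindowLocal
import HarnessLib
import HarnessLib.Audit.Tags

/-!
# Purely inseparable four-folds — K2(p), PHASE `d = 2`, PART XIII: ONE STEP OF THE SWAP-NORMALISED WINDOW (cell `res-dim4-pi`,
# K2(p) lane, brick «swap normalisation», FILE SN4b)

[OURS · counted 0 · cell `res-dim4-pi` · seat res-dim4-p-7 g3 · desk WORD #116.]  Nothing here proves K2(p), `NoIsolatedTrap p p`, or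
resolution of singularities in dimension ≥ 4 / characteristic `p`.  AI kernel work, weaker than expert review.

Along the located `d = 2` residue (`…ShadeTwoResidue.shadeTwo_located`) we carry a LIGHT re-presentation `B` of the chain state
`c k`: a letter bijection `π` (B's letter `i` ↔ the chain's letter `π i`; `π x = x` for the heavy letter, `π f` = the chain's free
letter), the ledger `B.r = (c k).r ∘ π`, and the relation `ℛ_π((c k).F, B.F)` of FILE SN3b.  **`swapWindow_step`**: whatever the
chain does at step `k` — a light step (chart ≠ free letter: mirrored by res-dim4-p-11 g3's SN3, here the explicit hypothesis
`hSN3`) or a SWAP (chart = free letter: first re-presented on the chain side by FILE SN1, then mirrored by SN3, relations composed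
by SN3b) — `B` makes a light step `B' = step p univ ℓ (γ' e_f) B` in a chart `ℓ ∉ {f, x}` with `π' ℓ = j k`, and all invariants
are re-established at level `M − p`; the dictionary changes by the transposition `(a, π f)` exactly at swaps (`a` = the letter the
swap translates), which is what reads the satellite condition on the light side.
bears_on: LADDER-RESOLUTION:D157-DOOR2 (res-dim4-pi · K2(p) · phase d = 2 · swap normalisation SN4b).  Supports
stmt-ResolutionOfSingularities-16155 (helper).
-/

set_option linter.dupNamespace false -- mandated namespace of this single-conjunct summit

noncomputable section

namespace Summit.ResolutionOfSingularities.ResolutionOfSingularities.Theorems.PIDim4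

namespace ResCone

open MvPolynomial Finset
open Literature.AlgebraicGeometry.Resolution
open Literature.AlgebraicGeometry.Resolution.CentreBlowup
open Literature.AlgebraicGeometry.Resolution.Hauser2010
open Literature.AlgebraicGeometry.Resolution.HauserPerlega2019
open SwapNorm

variable {K : Type} [Field K] [DecidableEq K]

variable {p : ℕ} [hp : Fact p.Prime] {c : ℕ → State K} {j : ℕ → Fin 4} {b : ℕ → Fin 4 → K}

omit [DecidableEq K] in
/-- Constant coefficient of an inverse modulo `x_g^M` (`M ≥ 1`): `P(0) · τ = 1`. [folklore] -/
theorem constantCoeff_of_inv_mod {g : Fin 4} {τ : K} {M : ℕ} {P : MvPolynomial (Fin 4) K} (hM : 1 ≤ M)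
    (hP : (X g + C τ) * P - 1 ∈ Ideal.span {(X g : MvPolynomial (Fin 4) K) ^ M}) : τ * constantCoeff P = 1 := by
  have h : constantCoeff ((X g + C τ) * P - 1) = 0 := by
    have h1 := ExceptionalLength.span_X_pow_le_originIdeal_pow g M hP
    exact (NarrowApolarity.mem_originIdeal_iff _).mp (Ideal.pow_le_self (by omega) h1)
  rw [map_sub, map_mul, map_add, constantCoeff_X, constantCoeff_C, zero_add, map_one, sub_eq_zero] at h
  exact h

/-- **ONE STEP OF THE SWAP-NORMALISED WINDOW** (see the file header). [OURS · K2(p) phase d = 2] [cite: Hauser2010, §§F–G]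
[folklore] -/
theorem swapWindow_step [CharP K p]
    (hSN3 : ∀ (π : Equiv.Perm (Fin 4)) (f : Fin 4) (M : ℕ) (A B : State K) (θ e : Fin 4 → MvPolynomial (Fin 4) K)
      (G U E : MvPolynomial (Fin 4) K),
      (∀ i, i ≠ f → θ (π i) = X i * e i) → θ (π f) = X f * e f + G → (∀ i, constantCoeff (e i) ≠ 0) →
      constantCoeff G = 0 → coeff (Finsupp.single f 1) G = 0 → constantCoeff U ≠ 0 → E ∈ originIdeal K ^ M →
      B.F = deletePthPowers p (U ^ p * aeval θ A.F) + E →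
      (p : ℕ∞) ≤ ordAlong Finset.univ A.F → (p : ℕ∞) ≤ ordAlong Finset.univ B.F →
      ∀ ℓ : Fin 4, ℓ ≠ f → ∀ γ γ' : K, γ * constantCoeff (e ℓ) = coeff (Finsupp.single ℓ 1) G + γ' * constantCoeff (e f) →
      ∃ (θ' e' : Fin 4 → MvPolynomial (Fin 4) K) (G' U' E' : MvPolynomial (Fin 4) K),
        (∀ i, i ≠ f → θ' (π i) = X i * e' i) ∧ θ' (π f) = X f * e' f + G' ∧ (∀ i, constantCoeff (e' i) ≠ 0) ∧
        constantCoeff G' = 0 ∧ coeff (Finsupp.single f 1) G' = 0 ∧ constantCoeff U' ≠ 0 ∧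
        E' ∈ originIdeal K ^ (M - p) ∧
        (CentreBlowup.step p Finset.univ ℓ (Pi.single f γ' : Fin 4 → K) B).F =
          deletePthPowers p (U' ^ p * aeval θ'
            (CentreBlowup.step p Finset.univ (π ℓ) (Pi.single (π f) γ : Fin 4 → K) A).F) + E')
    (hw : FreeTail.IsWitnessedChain p c j b)
    (hc : ∀ k, IsIsolated p (c k).F ∧ Step0 p (c k) (c (k + 1)) ∧ ordZero (c k).F ≠ p ∧ (c k).shade = 2)
    (hr0 : ∀ e ∈ (c 0).F.support, (c 0).r ≤ e) (h5 : 5 ≤ p) {k₁ : ℕ} {x : Fin 4}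
    (hloc : ∀ k, k₁ ≤ k → (c k).r.degree + 1 = p ∧ (c k).r x + 3 = p ∧ (c k).r (j k) ≤ 1 ∧ (c (k + 1)).r (j k) = 1 ∧
      ∃ f, f ≠ x ∧ (c k).r f = 0 ∧ coeff (Finsupp.single f 2) (resForm (c k)) ≠ 0 ∧ ∀ i, i ≠ x → i ≠ f → (c k).r i = 1)
    {k : ℕ} (hk : k₁ ≤ k) {f : Fin 4} {B : State K} {π : Equiv.Perm (Fin 4)} {M N : ℕ}
    (hπx : π x = x) (hπf : (c k).r (π f) = 0) (hBr : ∀ l, B.r l = (c k).r (π l))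
    {θ e : Fin 4 → MvPolynomial (Fin 4) K} {G U E : MvPolynomial (Fin 4) K}
    (hθi : ∀ i, i ≠ f → θ (π i) = X i * e i) (hθf : θ (π f) = X f * e f + G) (he : ∀ i, constantCoeff (e i) ≠ 0)
    (hG0 : constantCoeff G = 0) (hG1 : coeff (Finsupp.single f 1) G = 0) (hU : constantCoeff U ≠ 0)
    (hE : E ∈ originIdeal K ^ M) (hrel : B.F = deletePthPowers p (U ^ p * aeval θ (c k).F) + E)
    (hN : originIdeal K ^ N ≤ singLocusIdeal p (c k).F ⊔ originIdeal K ^ (N + 1)) (hM : N + p + 1 ≤ M) (hpM : p + 1 < M) :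
    ∃ (B' : State K) (π' : Equiv.Perm (Fin 4)) (ℓ : Fin 4) (γ' : K),
      B' = CentreBlowup.step p Finset.univ ℓ (Pi.single f γ' : Fin 4 → K) B ∧ ℓ ≠ f ∧ ℓ ≠ x ∧ π' ℓ = j k ∧ π' x = x ∧
      (c (k + 1)).r (π' f) = 0 ∧ (∀ l, B'.r l = (c (k + 1)).r (π' l)) ∧ deletePthPowers p B'.F = B'.F ∧
      ((π' = π ∧ j k ≠ π f) ∨ (∃ a, b k a ≠ 0 ∧ a ≠ π f ∧ j k = π f ∧ π' = π.trans (Equiv.swap a (π f)))) ∧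
      (IsIsolated p B.F ∧ ordZero B.F = (((c k).r.degree + 2 : ℕ) : ℕ∞)) ∧
      ∃ (θ' e' : Fin 4 → MvPolynomial (Fin 4) K) (G' U' E' : MvPolynomial (Fin 4) K),
        (∀ i, i ≠ f → θ' (π' i) = X i * e' i) ∧ θ' (π' f) = X f * e' f + G' ∧ (∀ i, constantCoeff (e' i) ≠ 0) ∧
        constantCoeff G' = 0 ∧ coeff (Finsupp.single f 1) G' = 0 ∧ constantCoeff U' ≠ 0 ∧
        E' ∈ originIdeal K ^ (M - p) ∧ B'.F = deletePthPowers p (U' ^ p * aeval θ' (c (k + 1)).F) + E' := by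
  classical
  -- the chain at `k` and `k + 1`
  obtain ⟨hck, hbj, -, -, ho_s, hpW, -, -⟩ := chain_step hw hc hr0 k
  obtain ⟨hWk, hxk, hjk, hjk1, fk, hfkx, hrfk, -, honek⟩ := hloc k hk
  obtain ⟨hWk1, hxk1, -, -, fk1, hfk1x, hrfk1, -, honek1⟩ := hloc (k + 1) (by omega)
  have huniq : ∀ g, (c k).r g = 0 → g = fk := by
    intro g hg
    by_contra hne
    by_cases hgx : g = x
    · rw [hgx] at hg; omega
    · have := honek g hgx hne; omega
  have huniq1 : ∀ g, (c (k + 1)).r g = 0 → g = fk1 := by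
    intro g hg
    by_contra hne
    by_cases hgx : g = x
    · rw [hgx] at hg; omega
    · have := honek1 g hgx hne; omega
  have hπfk : π f = fk := huniq _ hπf
  have hπfx : π f ≠ x := fun h => by rw [h] at hπf; omega
  -- readings of `B`
  have hA_ord : (p : ℕ∞) ≤ ordAlong Finset.univ (c k).F := (hw k).1
  have hpo : ¬ p ∣ (c k).r.degree + 2 := by
    rw [show (c k).r.degree + 2 = p + 1 by omega, Nat.dvd_add_right (dvd_refl p), Nat.dvd_one]
    exact hp.out.one_lt.ne'
  obtain ⟨hisoB, hordB⟩ := read_of_rel p hθi hθf he hG0 hG1 hU hE hrel (hc k).1 hN hM ho_s hpo (by omega)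
  have hB_ord : (p : ℕ∞) ≤ ordAlong Finset.univ B.F := by
    rw [ordAlong_univ, hordB]; exact_mod_cast (show p ≤ (c k).r.degree + 2 by omega)
  have hordeq : (ordAlong Finset.univ B.F).toNat = (ordAlong Finset.univ (c k).F).toNat := by
    rw [ordAlong_univ, ordAlong_univ, hordB, ho_s]
  -- translated letters leave, so every translation sits on the next free letter
  have hbzero : ∀ i, i ≠ fk1 → b k i = 0 := by
    intro i hi
    by_contra hne
    exact hi (huniq1 i (translated_step hw hc hr0 k hne).2.2.1)
  -- the new multiplicities, letter by letter, on both sides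
  have hrB' : ∀ (ℓ : Fin 4) (γ' : K) (l : Fin 4),
      (CentreBlowup.step p Finset.univ ℓ (Pi.single f γ' : Fin 4 → K) B).r l =
        if l = ℓ then (ordAlong Finset.univ (c k).F).toNat - p else if l = f then 0 else (c k).r (π l) := by
    intro ℓ γ' l
    rw [SwapNorm.step_r_apply, hordeq]
    by_cases hl : l = ℓ
    · rw [if_pos hl, if_pos hl]
    rw [if_neg hl, if_neg hl]
    by_cases hlf : l = f
    · subst hlf; rw [if_pos rfl, hBr, hπf, ite_self]
    · rw [if_neg hlf, Pi.single_eq_of_ne hlf, if_pos rfl, hBr]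
  have hrc' : ∀ l : Fin 4, (c (k + 1)).r l =
      if l = j k then (ordAlong Finset.univ (c k).F).toNat - p else if b k l = 0 then (c k).r l else 0 := by
    intro l; rw [hck]; exact SwapNorm.step_r_apply p (j k) (b k) (c k) l
  by_cases hsw : j k = π f
  · /- SWAP: the chain takes the chart of its free letter, translating the light letter `a := fk1` -/
    have hja : fk1 ≠ j k := fun h => by have := hjk1; rw [← h, hrfk1] at this; exact zero_ne_one this
    have haf : fk1 ≠ π f := by rw [← hsw]; exact hja
    have hβ : b k fk1 ≠ 0 := by
      intro h0
      have h := hrc' fk1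
      rw [if_neg hja, h0, if_pos rfl, hrfk1] at h
      exact haf ((huniq fk1 h.symm).trans hπfk.symm)
    have hb_single : b k = (Pi.single fk1 (b k fk1) : Fin 4 → K) := by
      funext i
      by_cases hia : i = fk1
      · rw [hia, Pi.single_eq_same]
      · rw [Pi.single_eq_of_ne hia, hbzero i hia]
    -- SN1: the light re-presentation `A''` of the chain's child
    have hτ : (b k fk1)⁻¹ ≠ 0 := inv_ne_zero hβ
    have hττ' : (b k fk1)⁻¹ * b k fk1 = 1 := inv_mul_cancel₀ hβ
    obtain ⟨P, hP⟩ := exists_inv_mod_X_pow (π f) hτ M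
    have hP0 : constantCoeff P ≠ 0 := by
      intro h0; have h := constantCoeff_of_inv_mod (by omega) hP; rw [h0, mul_zero] at h; exact zero_ne_one h
    obtain ⟨φ, hφ⟩ : ∃ φ : Fin 4 → MvPolynomial (Fin 4) K, φ = fun i =>
        if i = π f then X fk1 * (X (π f) + C (b k fk1)⁻¹) else if i = fk1 then -(C (b k fk1) * X (π f) * P)
        else X i * P := ⟨_, rfl⟩
    have hφf : φ (π f) = X fk1 * (X (π f) + C (b k fk1)⁻¹) := by rw [hφ]; exact if_pos rfl
    have hφa : φ fk1 = -(C (b k fk1) * X (π f) * P) := by rw [hφ]; dsimp only; rw [if_neg haf, if_pos rfl]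
    have hφi : ∀ i, i ≠ fk1 → i ≠ π f → φ i = X i * P := by
      intro i hia hif; rw [hφ]; dsimp only; rw [if_neg hif, if_neg hia]
    obtain ⟨A'', hA''⟩ : ∃ A'' : State K,
        A'' = CentreBlowup.step p Finset.univ fk1 (Pi.single (π f) (b k fk1)⁻¹ : Fin 4 → K) (c k) := ⟨_, rfl⟩
    have hSN1 := swap_step_F_mem p (s := c k) hA_ord haf hττ' hP hφf hφa hφi
    have hck' : CentreBlowup.step p Finset.univ (π f) (Pi.single fk1 (b k fk1) : Fin 4 → K) (c k) = c (k + 1) := by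
      rw [hck, ← hb_single, hsw]
    rw [hck', ← hA''] at hSN1
    -- as a relation `ℛ_σ((c (k+1)).F, A''.F)`, `σ = swap fk1 (π f)`, at level `M`
    obtain ⟨e₁, he₁⟩ : ∃ e₁ : Fin 4 → MvPolynomial (Fin 4) K, e₁ = fun i =>
        if i = fk1 then X (π f) + C (b k fk1)⁻¹ else if i = π f then -(C (b k fk1) * P) else P := ⟨_, rfl⟩
    have h1i : ∀ i, i ≠ π f → φ ((Equiv.swap fk1 (π f)) i) = X i * e₁ i := by
      intro i hif
      by_cases hia : i = fk1
      · rw [hia, Equiv.swap_apply_left, hφf, he₁]; dsimp only; rw [if_pos rfl]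
      · rw [Equiv.swap_apply_of_ne_of_ne hia hif, hφi i hia hif, he₁]; dsimp only; rw [if_neg hia, if_neg hif]
    have h1f : φ ((Equiv.swap fk1 (π f)) (π f)) = X (π f) * e₁ (π f) + 0 := by
      rw [Equiv.swap_apply_right, hφa, he₁, add_zero]; dsimp only; rw [if_neg haf.symm, if_pos rfl]; ring
    have he₁u : ∀ i, constantCoeff (e₁ i) ≠ 0 := by
      intro i; rw [he₁]; dsimp only
      split_ifs
      · rw [map_add, constantCoeff_X, constantCoeff_C, zero_add]; exact hτ
      · rw [map_neg, map_mul, constantCoeff_C, neg_ne_zero]; exact mul_ne_zero hβ hP0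
      · exact hP0
    have hU₁ : constantCoeff (X (π f) + C (b k fk1)⁻¹ : MvPolynomial (Fin 4) K) ≠ 0 := by
      rw [map_add, constantCoeff_X, constantCoeff_C, zero_add]; exact hτ
    have hE₁ := ExceptionalLength.span_X_pow_le_originIdeal_pow _ M hSN1
    have hrel₁ : A''.F = deletePthPowers p ((X (π f) + C (b k fk1)⁻¹) ^ p * aeval φ (c (k + 1)).F) +
        (A''.F - deletePthPowers p ((X (π f) + C (b k fk1)⁻¹) ^ p * aeval φ (c (k + 1)).F)) := by abel
    -- SN3: mirror the light step `c k → A''` on `B`, chart `ℓ := π⁻¹ fk1`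
    have hπℓ : π (π.symm fk1) = fk1 := Equiv.apply_symm_apply π fk1
    have hℓf : π.symm fk1 ≠ f := fun h => haf (by rw [← hπℓ, h])
    have hℓx : π.symm fk1 ≠ x := fun h => hfk1x (by rw [← hπℓ, h, hπx])
    obtain ⟨γ', hγ'⟩ : ∃ γ' : K, γ' = ((b k fk1)⁻¹ * constantCoeff (e (π.symm fk1)) -
        coeff (Finsupp.single (π.symm fk1) 1) G) / constantCoeff (e f) := ⟨_, rfl⟩
    have hγ : (b k fk1)⁻¹ * constantCoeff (e (π.symm fk1)) =
        coeff (Finsupp.single (π.symm fk1) 1) G + γ' * constantCoeff (e f) := by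
      rw [hγ', div_mul_cancel₀ _ (he f)]; ring
    obtain ⟨θ₂, e₂, G₂, U₂, E₂, h2i, h2f, he₂, hG₂0, hG₂1, hU₂, hE₂, hrel₂⟩ :=
      hSN3 π f M (c k) B θ e G U E hθi hθf he hG0 hG1 hU hE hrel hA_ord hB_ord (π.symm fk1) hℓf (b k fk1)⁻¹ γ' hγ
    rw [hπℓ, ← hA''] at hrel₂
    -- compose
    obtain ⟨θ', e', G', U', E', h'i, h'f, he', hG'0, hG'1, hU', hE', hrel'⟩ :=
      rel_comp p (π := π) (ρ := Equiv.swap fk1 (π f)) (f := f) h1i h1f he₁u (map_zero _) (coeff_zero _) hU₁ hE₁ hrel₁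
        h2i h2f he₂ hG₂0 hG₂1 hU₂ hE₂ hrel₂
    refine ⟨_, π.trans (Equiv.swap fk1 (π f)), π.symm fk1, γ', rfl, hℓf, hℓx, ?_, ?_, ?_, ?_,
      FrameChange.deletePthPowers_step_F p _ _ _ _, Or.inr ⟨fk1, hβ, haf, hsw, rfl⟩, ⟨hisoB, hordB⟩,
      θ', e', G', U', E', h'i, h'f, he', hG'0, hG'1, hU', ?_, hrel'⟩
    · rw [Equiv.trans_apply, hπℓ, Equiv.swap_apply_left, hsw]
    · rw [Equiv.trans_apply, hπx, Equiv.swap_apply_of_ne_of_ne hfk1x.symm hπfx.symm]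
    · rw [Equiv.trans_apply, Equiv.swap_apply_right, hrfk1]
    · intro l
      rw [hrB', hrc', Equiv.trans_apply]
      by_cases hl : l = π.symm fk1
      · rw [if_pos hl, hl, hπℓ, Equiv.swap_apply_left, if_pos hsw.symm]
      rw [if_neg hl]
      by_cases hlf : l = f
      · rw [if_pos hlf, hlf, Equiv.swap_apply_right, if_neg hja, hb_single, Pi.single_eq_same, if_neg hβ]
      · have hπl : π l ≠ fk1 := fun h => hl (by rw [← h, Equiv.symm_apply_apply])
        have hπlf : π l ≠ π f := fun h => hlf (π.injective h)
        rw [if_neg hlf, Equiv.swap_apply_of_ne_of_ne hπl hπlf, if_neg (by rw [hsw]; exact hπlf), hbzero _ hπl,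
          if_pos rfl]
    · rw [min_eq_right (Nat.sub_le M p)] at hE'; exact hE'
  · /- LIGHT: the chain's chart `j k ≠ π f` is exceptional; the translation sits on the free letter `π f` -/
    have hfree : (c (k + 1)).r (π f) = 0 := by
      rw [hck]; exact FrameChange.step_r_apply_eq_zero hπf hsw _
    have hfk1 : π f = fk1 := huniq1 _ hfree
    have hb_single : b k = (Pi.single (π f) (b k (π f)) : Fin 4 → K) := by
      funext i
      by_cases hia : i = π f
      · rw [hia, Pi.single_eq_same]
      · rw [Pi.single_eq_of_ne hia, hbzero i (by rw [← hfk1]; exact hia)]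
    have hπℓ : π (π.symm (j k)) = j k := Equiv.apply_symm_apply π (j k)
    have hℓf : π.symm (j k) ≠ f := fun h => hsw (by rw [← hπℓ, h])
    have hjx : j k ≠ x := fun h => by rw [h] at hjk; omega
    have hℓx : π.symm (j k) ≠ x := fun h => hjx (by rw [← hπℓ, h, hπx])
    obtain ⟨γ', hγ'⟩ : ∃ γ' : K, γ' = (b k (π f) * constantCoeff (e (π.symm (j k))) -
        coeff (Finsupp.single (π.symm (j k)) 1) G) / constantCoeff (e f) := ⟨_, rfl⟩
    have hγ : b k (π f) * constantCoeff (e (π.symm (j k))) =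
        coeff (Finsupp.single (π.symm (j k)) 1) G + γ' * constantCoeff (e f) := by
      rw [hγ', div_mul_cancel₀ _ (he f)]; ring
    obtain ⟨θ', e', G', U', E', h'i, h'f, he', hG'0, hG'1, hU', hE', hrel'⟩ :=
      hSN3 π f M (c k) B θ e G U E hθi hθf he hG0 hG1 hU hE hrel hA_ord hB_ord (π.symm (j k)) hℓf (b k (π f)) γ' hγ
    rw [hπℓ, ← hb_single, ← hck] at hrel'
    refine ⟨_, π, π.symm (j k), γ', rfl, hℓf, hℓx, hπℓ, hπx, hfree, ?_, FrameChange.deletePthPowers_step_F p _ _ _ _,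
      Or.inl ⟨rfl, hsw⟩, ⟨hisoB, hordB⟩, θ', e', G', U', E', h'i, h'f, he', hG'0, hG'1, hU', hE', hrel'⟩
    intro l
    rw [hrB', hrc']
    by_cases hl : l = π.symm (j k)
    · rw [if_pos hl, hl, hπℓ, if_pos rfl]
    rw [if_neg hl]
    have hπl : π l ≠ j k := fun h => hl (by rw [← h, Equiv.symm_apply_apply])
    rw [if_neg hπl]
    by_cases hlf : l = f
    · rw [if_pos hlf, hlf]
      by_cases hb0 : b k (π f) = 0
      · rw [hb0, if_pos rfl, hπf]
      · rw [if_neg hb0]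
    · rw [if_neg hlf, hb_single, Pi.single_eq_of_ne (fun h => hlf (π.injective h)), if_pos rfl]

end ResCone

end Summit.ResolutionOfSingularities.ResolutionOfSingularities.Theorems.PIDim4

end
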